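import Literature.RingTheory.CentralSimple.BaseChangeSimple
import Literature.RingTheory.CentralSimple.PositiveInvolutionSubfield
import Mathlib.RingTheory.SimpleModule.IsAlgClosed
import HarnessLib

/-!
# A skew field of dimension six over `ℚ` is commutative (the reduced degree of a division algebra is a square)

Family `hodge` (consumer: `AlgebraicGeometry/HodgeTheory/SimpleAbelianThreefoldCubicEndPowersHodgeClasses`, the
case `dim_ℚ End⁰(X) = 6` of a simple abelian threefold), layer `Literature/RingTheory/CentralSimple`. UNCONDITIONAL
algebra; theorems only, no definition, no named fact (D-0026), no `sorry`.

WHAT IS PROVED. For a skew field `D` of finite dimension over `ℚ` with centre `Z`: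
* `DivisionRing.isSquare_finrank_center` — `[D : Z]` is a perfect square: for an embedding `Z → ℂ`, the algebra
  `ℂ ⊗_Z D` is simple (the tree's `isSimpleRing_tensorProduct`, `D` being central simple over `Z`) and
  finite-dimensional over the algebraically closed field `ℂ`, hence a full matrix algebra `M_n(ℂ)` (Mathlib's
  Wedderburn–Artin `IsSimpleRing.exists_algEquiv_matrix_of_isAlgClosed`), so `[D : Z] = dim_ℂ(ℂ ⊗_Z D) = n²`.
* `DivisionRing.mul_comm_of_finrank_eq_six` — if `dim_ℚ D = 6` then `D` is commutative (`6 = [Z:ℚ]·n²` forces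
  `n = 1`, i.e. `D = Z`).
(Swinnerton-Dyer, Analytic theory of abelian varieties, §8: «let D be a division algebra of dimension m² over its
centre K»; Lange §2.6.1: «dim_ℚ F = e d²».)

## References

* [SwinnertonDyer1974] H. P. F. Swinnerton-Dyer, Analytic Theory of Abelian Varieties, LMS Lecture Note Series 14
  (1974), §8 (p. 63) [corpus: book:swinnerton-dyer1974-analytic-theory-abelian-varieties p0063 L3–L9].
* [Lange2023AbelianVarietiesComplex] H. Lange, Abelian Varieties over the Complex Numbers (2023), §2.6.1.
* B. Farb, R. K. Dennis, Noncommutative Algebra, GTM 144 (1993), Ch. 3–4.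
-/

noncomputable section

open Module
open scoped TensorProduct

namespace Literature.RingTheory.CentralSimple

universe u

variable {D : Type u} [DivisionRing D] [CharZero D] [Module.Finite ℚ D]

omit [CharZero D] [Module.Finite ℚ D] in
/-- `D` is central over its centre. [folklore] -/
private theorem DivisionRing.isCentral_center : Algebra.IsCentral (Subring.center D) D := by
  refine ⟨fun x hx => ?_⟩
  rw [Subalgebra.mem_center_iff] at hx
  rw [Algebra.mem_bot]
  exact ⟨⟨x, Subring.mem_center_iff.2 fun y => (hx y)⟩, rfl⟩

/-- `D` is finite over its centre `Z` (it is finite over `ℚ ⊆ Z`). [folklore] -/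
private theorem DivisionRing.finite_center : Module.Finite (Subring.center D) D := by
  classical
  -- the `ℚ`-span of a finite generating set is contained in its `Z`-span
  obtain ⟨s, hs⟩ := Module.Finite.fg_top (R := ℚ) (M := D)
  refine ⟨⟨s, ?_⟩⟩
  rw [eq_top_iff]
  rintro x -
  have hx : x ∈ Submodule.span ℚ (s : Set D) := by rw [hs]; exact Submodule.mem_top
  induction hx using Submodule.span_induction with
  | mem y hy => exact Submodule.subset_span hy
  | zero => exact Submodule.zero_mem _
  | add y z _ _ hy hz => exact Submodule.add_mem _ hy hz
  | smul q y _ hy =>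
    have hq : (q • y : D) = ((q : Subring.center D) : Subring.center D) • y := by
      rw [Algebra.smul_def, Algebra.smul_def]
      congr 1
      rw [eq_ratCast]
      exact (algebraMap.coe_ratCast (Subring.center D) D q).symm
    rw [hq]
    exact Submodule.smul_mem _ _ hy

/-- **The dimension of a skew field over its centre is a square** (`[D : Z] = n²`, the square of the reduced
degree): base change to `ℂ` along an embedding of the number field `Z` gives a simple finite-dimensional
`ℂ`-algebra, i.e. a matrix algebra `M_n(ℂ)` (Wedderburn–Artin). [cite: SwinnertonDyer1974, §8 (p. 63)]
[cite: Lange2023AbelianVarietiesComplex, §2.6.1 (dim_ℚ F = e d²)] -/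
theorem DivisionRing.isSquare_finrank_center : IsSquare (Module.finrank (Subring.center D) D) := by
  classical
  haveI : NumberField (Subring.center D) := numberField_center
  haveI : Algebra.IsCentral (Subring.center D) D := DivisionRing.isCentral_center
  haveI : Module.Finite (Subring.center D) D := DivisionRing.finite_center
  obtain ⟨σ⟩ : Nonempty (Subring.center D →+* ℂ) := inferInstance
  letI : Algebra (Subring.center D) ℂ := σ.toAlgebra
  haveI : IsSimpleRing (ℂ ⊗[Subring.center D] D) := isSimpleRing_tensorProduct ℂ
  obtain ⟨n, _, ⟨e⟩⟩ := IsSimpleRing.exists_algEquiv_matrix_of_isAlgClosed ℂ (ℂ ⊗[Subring.center D] D)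
  refine ⟨n, ?_⟩
  rw [← Module.finrank_baseChange (R := ℂ), e.toLinearEquiv.finrank_eq, Module.finrank_matrix, Fintype.card_fin,
    Module.finrank_self, mul_one]

/-- **A skew field of dimension `6` over `ℚ` is commutative**: `6 = [Z : ℚ]·[D : Z] = [Z : ℚ]·n²` forces `n = 1`,
so `D` equals its centre. [cite: SwinnertonDyer1974, §8 (p. 63)] [cite: Lange2023AbelianVarietiesComplex, §2.6.1] -/
theorem DivisionRing.mul_comm_of_finrank_eq_six (h6 : Module.finrank ℚ D = 6) (x y : D) : x * y = y * x := by
  classical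
  haveI : NumberField (Subring.center D) := numberField_center
  haveI : Module.Finite (Subring.center D) D := DivisionRing.finite_center
  obtain ⟨n, hn⟩ := DivisionRing.isSquare_finrank_center (D := D)
  -- the tower `ℚ ⊆ Z ⊆ D`
  haveI : IsScalarTower ℚ (Subring.center D) D := IsScalarTower.of_algebraMap_smul fun q d => by
    rw [Algebra.smul_def, Algebra.smul_def, eq_ratCast, eq_ratCast]
    congr 1
    exact algebraMap.coe_ratCast (Subring.center D) D q
  have htower := Module.finrank_mul_finrank ℚ (Subring.center D) D
  rw [h6, hn] at htower
  -- `[Z:ℚ] · n² = 6` with `[Z:ℚ] ≥ 1` forces `n = 1`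
  have hZpos : 0 < Module.finrank ℚ (Subring.center D) := Module.finrank_pos
  have hn1 : n = 1 := by
    have hle : n * n ≤ 6 := by
      calc n * n ≤ Module.finrank ℚ (Subring.center D) * (n * n) := Nat.le_mul_of_pos_left _ hZpos
        _ = 6 := htower
    have hn3 : n < 3 := by nlinarith
    interval_cases n
    · omega
    · rfl
    · omega
  rw [hn1, mul_one] at hn
  -- `[D : Z] = 1`: every element is central
  have hcentral : ∀ d : D, d ∈ Subring.center D := by
    intro d
    obtain ⟨c, hc⟩ := (finrank_eq_one_iff_of_nonzero' (1 : D) one_ne_zero).1 hn d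
    rw [← hc, Algebra.smul_def, mul_one]
    exact c.2
  exact (Subring.mem_center_iff.1 (hcentral x) y).symm


/-! ## The `Ring`/`Algebra ℚ` form (for `End⁰` of a simple abelian variety, a type synonym with no `DivisionRing`
instance) -/

section OfIsUnit

/-- Transfer of `finrank ℚ` and `Module.Finite ℚ` between the (equal, `subsingleton_rat_module`) `ℚ`-module
structures on one additive group. [folklore] -/
private theorem ratModule_transfer' {M : Type*} [AddCommGroup M] (i₁ i₂ : Module ℚ M) :
    @Module.finrank ℚ M _ _ i₁ = @Module.finrank ℚ M _ _ i₂ ∧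
      (@Module.Finite ℚ M _ _ i₁ → @Module.Finite ℚ M _ _ i₂) := by
  obtain rfl : i₁ = i₂ := Subsingleton.elim _ _
  exact ⟨rfl, id⟩

/-- **A `ℚ`-algebra of dimension `6` in which every element is a unit or zero is commutative** (the
`DivisionRing`-free form of `DivisionRing.mul_comm_of_finrank_eq_six`, for type synonyms such as `End⁰(X)` of a
simple abelian variety). [cite: SwinnertonDyer1974, §8 (p. 63)] [cite: Lange2023AbelianVarietiesComplex, §2.6.1] -/
theorem mul_comm_of_finrank_eq_six_of_isUnit_or_eq_zero {R : Type u} [Ring R] [Algebra ℚ R] [Module.Finite ℚ R]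
    (hR : ∀ a : R, IsUnit a ∨ a = 0) (h6 : Module.finrank ℚ R = 6) (x y : R) : x * y = y * x := by
  haveI : Nontrivial R := Module.nontrivial_of_finrank_pos (R := ℚ) (by rw [h6]; norm_num)
  letI : DivisionRing R := DivisionRing.ofIsUnitOrEqZero hR
  haveI : CharZero R := charZero_of_injective_algebraMap (algebraMap ℚ R).injective
  have ht := ratModule_transfer' (M := R) (Algebra.toModule (A := R) (R := ℚ))
    (@Algebra.toModule ℚ R _ _ DivisionRing.toRatAlgebra)
  haveI : @Module.Finite ℚ R _ _ (@Algebra.toModule ℚ R _ _ DivisionRing.toRatAlgebra) := ht.2 inferInstance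
  have h6' : @Module.finrank ℚ R _ _ (@Algebra.toModule ℚ R _ _ DivisionRing.toRatAlgebra) = 6 := by
    rw [← ht.1, h6]
  exact @DivisionRing.mul_comm_of_finrank_eq_six R _ _ _ h6' x y

end OfIsUnit

end Literature.RingTheory.CentralSimple

end
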